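/- Free lead seat `ym-line-cbag-p1` (prover-ym-line-cbag-p1-g20-0; own crux `BoxFloorAllGroups` stmt-QuantumFields-22254 CLOSED): the zero-ask
by-product flagged by planner ym-idea-2 g3 and endorsed by critic idea-crit-4 (2026-08-28 07:36Z, P4): the infrared half `XiUnbounded` of the
hypothesis `StandardScalingSU` of the landed negative lemma `latticeGapInUVUnits_false_of_standardScalingSU` (crux `LatticeGapInUVUnits`,
stmt-QuantumFields-9366, route `LangevinControlUV`) is now a THEOREM for every compact simple `G`, from the landed `xiDiverges_proof`.
RECORD-level lattice statements; the Yang–Mills mass gap is NOT proved by anything here. -/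
import Summits.QuantumFields.YangMills.Theorems.DirichletWindowXiDivergesOfLocalGaussianity
import Summits.QuantumFields.YangMills.Theorems.DirichletWindowCriticalityOfXiDiverges
import Summits.QuantumFields.YangMills.Theorems.LatticeGapInUVUnits.Negative.LatticeGapInUVUnitsFalseOfStandardScalingSU
import Literature.MathematicalPhysics.QuantumLattice.GaugeGroupsProofs

/-!
# `XiUnbounded` holds for every compact simple `G`; the negative lemma for `LatticeGapInUVUnits` modulo its ultraviolet half only

`XiUnbounded r` (`LatticeGapInUVUnits/Negative/LatticeGapInUVUnitsFalseOfStandardScalingSU.lean`): two gauge-invariant local observables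
`A, B` such that for every rate `ε > 0` there are ARBITRARILY LARGE couplings `β` at which `⟨A · τ_n B⟩ − ⟨A⟩⟨B⟩` on the odd tori is not
`O(e^{−ε n})` uniformly (`∀ S₀ C ∃ S ≥ S₀ ∃ n ≤ S, C e^{−ε n} < |latticeConnectedCorr r.ρ β (2S+1) A B n|`).

**Proof** (`xiUnbounded_of_isCompactSimpleLieGroup`). Take `A = B =` the `(0,1)`-plaquette at the origin (`plaquetteObservable`).  Given
`ε > 0` and `b`, let `β := max b β₁(ε/2)` with `β₁` from the landed `xiDiverges_proof` (route `DirichletWindow`: every torus-limit state at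
`β ≥ β₁(ε/2)` has `f_β(n e₀) ≥ A' e^{−m n}` with `A' > 0`, `m ≤ ε/2`).  If for some `S₀, C` all tori `S ≥ S₀` had
`|corr_{β,2S+1}(n)| ≤ C e^{−ε n}` for all `n ≤ S`, then a limit state `μ` along the odd tori
(`CriticalityOfXiDiverges.exists_isInfiniteVolumeLimitAlong_odd`) would have `f_β(n e₀) ≤ C e^{−ε n}` for all `n`
(`CriticalityOfXiDiverges.plaquetteCorrFn_le_of_abs_latticeConnectedCorr_le`), incompatible with the floor of rate `m ≤ ε/2 < ε`
(`CriticalityOfXiDiverges.false_of_exp_lower_le_upper`).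

**Consequences.** `xiUnbounded_suFund` (`SU(N)`, `N ≥ 2`, fundamental representation; `SU(N)` is compact simple in the tree,
`isSimpleCompactGroup_specialUnitaryGroup_holds`); `standardScalingSU_of_fixedTorusTwoSided`: the hypothesis `StandardScalingSU` of the negative
lemma reduces to its ULTRAVIOLET half `∃ N ≥ 2, FixedTorusTwoSided (suFund N)` (fixed-torus `β → ∞` two-sided plaquette covariances, Lüscher 1983 /
Coste et al. 1985 — still open as a theorem); `latticeGapInUVUnits_false_of_fixedTorusTwoSided`: the crux `LatticeGapInUVUnits` AS TYPED is false
modulo that ultraviolet statement alone.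

Sources: S. Chatterjee, arXiv:1803.01950, Problem 5.1; E. Seiler, LNP 159 (1982) Ch. 2.  NOT the Yang–Mills mass gap; no summit statement is
proved or refuted here (the negative lemma stays conditional on `FixedTorusTwoSided`).
-/

noncomputable section

open MeasureTheory Filter Topology
open Literature.MathematicalPhysics.QuantumFieldTheory
open Literature.MathematicalPhysics.QuantumLattice

namespace Summit.QuantumFields.YangMills.Theorems.LatticeGapInUVUnits.Negative

/-- **`XiUnbounded r` for every compact simple `G` and every faithful unitary lattice representation `r`** (infrared half of
`StandardScalingSU`, now unconditional): the `(0,1)`-plaquette pair clusters, at every `β ≥ β₁(ε/2)` of `xiDiverges_proof`, more slowly than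
`e^{−ε n}` on the large odd tori — otherwise an odd-torus limit state would violate the landed floor `f_β(n e₀) ≥ A' e^{−(ε/2) n}`.
[folklore] -/
theorem xiUnbounded_of_isCompactSimpleLieGroup {G : Type} [Group G] [TopologicalSpace G] [IsTopologicalGroup G]
    [CompactSpace G] [MeasurableSpace G] [BorelSpace G] (hG : IsCompactSimpleLieGroup G) (r : LatticeRep G) :
    XiUnbounded r := by
  haveI : SecondCountableTopology G :=
    (r.continuous.isClosedEmbedding r.injective).isEmbedding.secondCountableTopology
  haveI : T2Space G := (r.continuous.isClosedEmbedding r.injective).isEmbedding.t2Space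
  refine ⟨plaquetteObservable (d := 4) r.ρ r.continuous 0 1, plaquetteObservable (d := 4) r.ρ r.continuous 0 1,
    fun ε hε b => ?_⟩
  obtain ⟨β₁, hβ₁⟩ := xiDiverges_proof G hG r (ε / 2) (half_pos hε)
  refine ⟨max b β₁, le_max_left _ _, fun S₀ C => ?_⟩
  by_contra hcon
  push Not at hcon
  obtain ⟨μ, φ, hφ, hμ⟩ :=
    CriticalityOfXiDiverges.exists_isInfiniteVolumeLimitAlong_odd (d := 4) r.ρ r.continuous (max b β₁)
  have hμmem : μ ∈ infiniteVolumeLimitPoints (d := 4) r.ρ (max b β₁) :=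
    ⟨fun k => 2 * φ k, fun _ _ hab => by dsimp only; have := hφ hab; omega, hμ⟩
  obtain ⟨m', A', hA', -, hm'le, hlow⟩ := hβ₁ (max b β₁) (le_max_right _ _) μ hμmem
  have hup : ∀ n : ℕ, plaquetteCorrFn r.ρ μ ((n : ℤ) • Pi.single (0 : Fin 4) (1 : ℤ)) ≤
      C * Real.exp (-(ε * n)) := fun n =>
    CriticalityOfXiDiverges.plaquetteCorrFn_le_of_abs_latticeConnectedCorr_le r.ρ r.continuous hφ hμ
      (S₀ := S₀) (fun S hS hn => hcon S hS n hn)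
  exact CriticalityOfXiDiverges.false_of_exp_lower_le_upper hA' (by linarith) fun n => (hlow n).trans (hup n)

/-- **`XiUnbounded` for `SU(N)`, `N ≥ 2`, in the fundamental representation** (Borel σ-algebra from the topology, as in `StandardScalingSU`).
[folklore] -/
theorem xiUnbounded_suFund {N : ℕ} (hN : 2 ≤ N) :
    letI : MeasurableSpace (Matrix.specialUnitaryGroup (Fin N) ℂ) := borel _
    haveI : BorelSpace (Matrix.specialUnitaryGroup (Fin N) ℂ) := ⟨rfl⟩
    XiUnbounded (suFund N) := by
  letI : MeasurableSpace (Matrix.specialUnitaryGroup (Fin N) ℂ) := borel _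
  haveI : BorelSpace (Matrix.specialUnitaryGroup (Fin N) ℂ) := ⟨rfl⟩
  exact xiUnbounded_of_isCompactSimpleLieGroup
    (isCompactSimpleLieGroup_specialUnitaryGroup isSimpleCompactGroup_specialUnitaryGroup_holds hN) (suFund N)

/-- **`StandardScalingSU` reduces to its ultraviolet half**: the fixed-torus two-sided asymptotics `FixedTorusTwoSided (suFund N)` for some
`N ≥ 2` already give `StandardScalingSU`, the infrared half being `xiUnbounded_suFund`. [folklore] -/
theorem standardScalingSU_of_fixedTorusTwoSided
    (h : ∃ N : ℕ, 2 ≤ N ∧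
      letI : MeasurableSpace (Matrix.specialUnitaryGroup (Fin N) ℂ) := borel _
      haveI : BorelSpace (Matrix.specialUnitaryGroup (Fin N) ℂ) := ⟨rfl⟩
      FixedTorusTwoSided (suFund N)) :
    StandardScalingSU := by
  obtain ⟨N, hN, hT⟩ := h
  exact ⟨N, hN, hT, xiUnbounded_suFund hN⟩

/-- **The negative lemma for the crux `LatticeGapInUVUnits` (stmt-QuantumFields-9366) modulo its ULTRAVIOLET hypothesis only**: if for some
`N ≥ 2` the plaquette covariances of every fixed torus of `SU(N)₄` are two-sided `≍ β⁻² dist⁻⁸` beyond a threshold (`FixedTorusTwoSided`,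
femto-universe perturbation theory — open as a theorem), then `LatticeGapInUVUnits` as typed is false
(`latticeGapInUVUnits_false_of_standardScalingSU` with its infrared half discharged by `xiUnbounded_suFund`).  NOT a refutation of the item
(conditional on `FixedTorusTwoSided`); NOT the Yang–Mills mass gap. [folklore] -/
theorem latticeGapInUVUnits_false_of_fixedTorusTwoSided
    (h : ∃ N : ℕ, 2 ≤ N ∧
      letI : MeasurableSpace (Matrix.specialUnitaryGroup (Fin N) ℂ) := borel _
      haveI : BorelSpace (Matrix.specialUnitaryGroup (Fin N) ℂ) := ⟨rfl⟩
      FixedTorusTwoSided (suFund N)) :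
    ¬ Summit.QuantumFields.YangMills.Theses.LangevinControlUV.LatticeGapInUVUnits :=
  latticeGapInUVUnits_false_of_standardScalingSU (standardScalingSU_of_fixedTorusTwoSided h)

end Summit.QuantumFields.YangMills.Theorems.LatticeGapInUVUnits.Negative

end
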